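import Summits.ValiantsHypothesis.ValiantsHypothesis.Theses.UlrichPadded
import Literature.Computability.AlgebraicComplexity.StandardFamiliesProofs
import Literature.Computability.AlgebraicComplexity.RankOneDeterminantalExpressionsProofs

/-!
# `UlrichPadded.RankOneTrivialisation` (stmt-ValiantsHypothesis-5667): no unit cofactor, no unimodular cofactor column

Negative knowledge for the crux (standing disprover, cycle 2, 2026-08-16).  Grenet's `7 × 7`
representation `gA` of `per₃` has the unit cofactor `(adj gA)_{ss} = 1` (checked in the crux work file
`Cruxes/RankOneTrivialisation/Disproof.lean`, `adjugate_gA_ss`), which suggests two natural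
strengthenings of the rank-one trivialisation `adj A ≡ c wᵀ (mod per_n)`:

* "some cofactor of `A` is a non-zero constant modulo `per_n`" (normalise `c_s = w_s = 1`), and
* "some column of cofactors is unimodular modulo `per_n`" (the cyclic vector of the invertible
  cokernel may be taken to be a coordinate vector `e_j`).

Both are FALSE: `not_unitCofactor`, `not_unimodularColumn`.  Witness: the CONSTANT two-sided gauge
`Bc = Pc · gA · Qc` (`Pc = 1 - E_{u₀ s}`, `Qc = 1 - E_{s v₂}`, `det Pc = det Qc = 1`), a `7 × 7` affine
representation of `per₃` whose row `s` vanishes at the origin and whose row `u₀` vanishes at the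
point `p₁ ∈ V(per₃)` (`x₀₀ = x₂₂ = 1`, rest `0`); hence every column of `adj Bc` dies at a point of the
hypersurface and generates with `per₃` a proper ideal.  Lesson for the lines: vzG's unit content is a
property of all `m²` cofactors jointly; the trivialising sections `c, w` are in general non-constant in
every entry; "WLOG `c_s = 1`" is not available, "WLOG (after a constant gauge) `c(0) = e_s`" is.
Both strengthenings are stated inline (no new named facts); the matrices are introduced inside the
proofs, so the file declares theorems only.
-/

noncomputable section

namespace Summit.ValiantsHypothesis.Theorems.RankOneTrivialisationNegative.UnitCofactor

open MvPolynomial Matrix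
open Literature.Computability.AlgebraicComplexity

/-- Cofactors in every column `j ≠ r` of a matrix whose row `r` vanishes are zero. [folklore] -/
theorem adjugate_eq_zero_of_row_eq_zero {R : Type*} [CommRing R] {m : ℕ}
    (M : Matrix (Fin m) (Fin m) R) (r : Fin m) (hr : ∀ k, M r k = 0) (i j : Fin m) (hj : j ≠ r) :
    M.adjugate i j = 0 := by
  rw [Matrix.adjugate_apply]
  exact Matrix.det_eq_zero_of_row_eq_zero r fun k => by rw [Matrix.updateRow_ne hj.symm]; exact hr k

/-- A unit cofactor makes its column unimodular modulo `per_n`. [folklore] -/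
theorem unimodularColumn_of_unitCofactor {n m : ℕ}
    (A : Matrix (Fin m) (Fin m) (MvPolynomial (Fin n × Fin n) ℂ)) {i j : Fin m} {κ : ℂ} (hκ : κ ≠ 0)
    (hmem : A.adjugate i j - C κ ∈ Ideal.span {perPoly (Fin n) ℂ}) :
    (1 : MvPolynomial (Fin n × Fin n) ℂ) ∈
      Ideal.span (insert (perPoly (Fin n) ℂ) (Set.range fun i => A.adjugate i j)) := by
  set J := Ideal.span (insert (perPoly (Fin n) ℂ) (Set.range fun i => A.adjugate i j))
  have h1 : A.adjugate i j ∈ J := Ideal.subset_span (Set.mem_insert_of_mem _ ⟨i, rfl⟩)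
  have h2 : A.adjugate i j - C κ ∈ J :=
    Ideal.span_mono (Set.singleton_subset_iff.2 (Set.mem_insert _ _)) hmem
  have h3 : C κ ∈ J := by simpa using J.sub_mem h1 h2
  have h4 := J.mul_mem_left (C κ⁻¹) h3
  rwa [← C_mul, inv_mul_cancel₀ hκ, C_1] at h4

set_option maxHeartbeats 3200000 in
/-- **"Some cofactor column is unimodular modulo `per_n`" is false.** Witness: the constant gauge
`Bc = Pc · gA · Qc` of Grenet's `7 × 7` representation of `per₃`; every column of `adj Bc` dies at the
origin (columns `≠ s`, where row `s` of `Bc` vanishes) or at `p₁` (column `s`, where row `u₀` vanishes).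
[folklore] -/
theorem not_unimodularColumn :
    ¬ ∀ n : ℕ, 3 ≤ n → ∀ (m : ℕ) (A : Matrix (Fin m) (Fin m) (MvPolynomial (Fin n × Fin n) ℂ)),
      IsAffineDetRepr (perPoly (Fin n) ℂ) A →
      ∃ j : Fin m, (1 : MvPolynomial (Fin n × Fin n) ℂ) ∈
        Ideal.span (insert (perPoly (Fin n) ℂ) (Set.range fun i => A.adjugate i j)) := by
  intro h
  -- `per₃` written out
  obtain ⟨per₃, hper₃⟩ : ∃ p : MvPolynomial (Fin 3 × Fin 3) ℂ, p =
      X (0, 0) * (X (1, 1) * X (2, 2) + X (2, 1) * X (1, 2)) +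
        X (1, 0) * (X (0, 1) * X (2, 2) + X (2, 1) * X (0, 2)) +
        X (2, 0) * (X (0, 1) * X (1, 2) + X (1, 1) * X (0, 2)) := ⟨_, rfl⟩
  have perPoly_three_eq : perPoly (Fin 3) ℂ = per₃ := by
    rw [perPoly, permanent_fin_three, hper₃]
    simp only [Matrix.mvPolynomialX_apply]
  -- Grenet's matrix (rows/columns `s, u₀, u₁, u₂, v₀, v₁, v₂`) and the unipotent factors computing its determinant
  obtain ⟨gA, hgA⟩ : ∃ M : Matrix (Fin 7) (Fin 7) (MvPolynomial (Fin 3 × Fin 3) ℂ), M =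
      !![0, X (0, 0), X (1, 0), X (2, 0), 0, 0, 0;
         0, 1, 0, 0, 0, X (2, 1), X (1, 1);
         0, 0, 1, 0, X (2, 1), 0, X (0, 1);
         0, 0, 0, 1, X (1, 1), X (0, 1), 0;
         X (0, 2), 0, 0, 0, 1, 0, 0;
         X (1, 2), 0, 0, 0, 0, 1, 0;
         X (2, 2), 0, 0, 0, 0, 0, 1] := ⟨_, rfl⟩
  obtain ⟨E₁, hE₁⟩ : ∃ M : Matrix (Fin 7) (Fin 7) (MvPolynomial (Fin 3 × Fin 3) ℂ), M =
      !![1, 0, 0, 0, 0, 0, 0;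
         0, 1, 0, 0, 0, -X (2, 1), -X (1, 1);
         0, 0, 1, 0, -X (2, 1), 0, -X (0, 1);
         0, 0, 0, 1, -X (1, 1), -X (0, 1), 0;
         0, 0, 0, 0, 1, 0, 0;
         0, 0, 0, 0, 0, 1, 0;
         0, 0, 0, 0, 0, 0, 1] := ⟨_, rfl⟩
  obtain ⟨E₂, hE₂⟩ : ∃ M : Matrix (Fin 7) (Fin 7) (MvPolynomial (Fin 3 × Fin 3) ℂ), M =
      !![1, 0, 0, 0, 0, 0, 0;
         0, 1, 0, 0, 0, 0, 0;
         0, 0, 1, 0, 0, 0, 0;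
         0, 0, 0, 1, 0, 0, 0;
         -X (0, 2), 0, 0, 0, 1, 0, 0;
         -X (1, 2), 0, 0, 0, 0, 1, 0;
         -X (2, 2), 0, 0, 0, 0, 0, 1] := ⟨_, rfl⟩
  obtain ⟨A₁, hA₁⟩ : ∃ M : Matrix (Fin 7) (Fin 7) (MvPolynomial (Fin 3 × Fin 3) ℂ), M =
      !![0, X (0, 0), X (1, 0), X (2, 0), -(X (1, 0) * X (2, 1) + X (2, 0) * X (1, 1)),
           -(X (0, 0) * X (2, 1) + X (2, 0) * X (0, 1)), -(X (0, 0) * X (1, 1) + X (1, 0) * X (0, 1));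
         0, 1, 0, 0, 0, 0, 0;
         0, 0, 1, 0, 0, 0, 0;
         0, 0, 0, 1, 0, 0, 0;
         X (0, 2), 0, 0, 0, 1, 0, 0;
         X (1, 2), 0, 0, 0, 0, 1, 0;
         X (2, 2), 0, 0, 0, 0, 0, 1] := ⟨_, rfl⟩
  obtain ⟨T₇, hT₇⟩ : ∃ M : Matrix (Fin 7) (Fin 7) (MvPolynomial (Fin 3 × Fin 3) ℂ), M =
      !![per₃, X (0, 0), X (1, 0), X (2, 0), -(X (1, 0) * X (2, 1) + X (2, 0) * X (1, 1)),
           -(X (0, 0) * X (2, 1) + X (2, 0) * X (0, 1)), -(X (0, 0) * X (1, 1) + X (1, 0) * X (0, 1));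
         0, 1, 0, 0, 0, 0, 0;
         0, 0, 1, 0, 0, 0, 0;
         0, 0, 0, 1, 0, 0, 0;
         0, 0, 0, 0, 1, 0, 0;
         0, 0, 0, 0, 0, 1, 0;
         0, 0, 0, 0, 0, 0, 1] := ⟨_, rfl⟩
  have gA_mul_E₁ : gA * E₁ = A₁ := by
    rw [hgA, hE₁, hA₁]
    refine Matrix.ext fun i j => ?_
    fin_cases i <;> fin_cases j <;> simp [Matrix.mul_apply, Fin.sum_univ_seven]
    all_goals ring
  have A₁_mul_E₂ : A₁ * E₂ = T₇ := by
    rw [hA₁, hE₂, hT₇, hper₃]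
    refine Matrix.ext fun i j => ?_
    fin_cases i <;> fin_cases j <;> simp [Matrix.mul_apply, Fin.sum_univ_seven]
    all_goals ring
  have hE₁t : E₁.BlockTriangular id := by
    rw [hE₁]; intro i j hij
    fin_cases i <;> fin_cases j <;> first | exact absurd hij (by decide) | simp
  have det_E₁ : E₁.det = 1 := by
    rw [Matrix.det_of_upperTriangular hE₁t, Fin.prod_univ_seven, hE₁]; simp
  have hE₂t : E₂.BlockTriangular OrderDual.toDual := by
    rw [hE₂]; intro i j hij
    fin_cases i <;> fin_cases j <;> first | exact absurd hij (by decide) | simp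
  have det_E₂ : E₂.det = 1 := by
    rw [Matrix.det_of_lowerTriangular E₂ hE₂t, Fin.prod_univ_seven, hE₂]; simp
  have hT₇t : T₇.BlockTriangular id := by
    rw [hT₇]; intro i j hij
    fin_cases i <;> fin_cases j <;> first | exact absurd hij (by decide) | simp
  have det_T₇ : T₇.det = perPoly (Fin 3) ℂ := by
    rw [Matrix.det_of_upperTriangular hT₇t, Fin.prod_univ_seven, perPoly_three_eq, hT₇]; simp
  have det_gA : gA.det = perPoly (Fin 3) ℂ := by
    have h := congrArg Matrix.det A₁_mul_E₂
    rwa [← gA_mul_E₁, Matrix.det_mul, Matrix.det_mul, det_E₁, det_E₂, det_T₇, mul_one, mul_one] at h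
  -- the constant gauge `Bc = Pc · gA · Qc`
  obtain ⟨Pc, hPc⟩ : ∃ M : Matrix (Fin 7) (Fin 7) (MvPolynomial (Fin 3 × Fin 3) ℂ), M =
      !![1, 0, 0, 0, 0, 0, 0;
         -1, 1, 0, 0, 0, 0, 0;
         0, 0, 1, 0, 0, 0, 0;
         0, 0, 0, 1, 0, 0, 0;
         0, 0, 0, 0, 1, 0, 0;
         0, 0, 0, 0, 0, 1, 0;
         0, 0, 0, 0, 0, 0, 1] := ⟨_, rfl⟩
  obtain ⟨Qc, hQc⟩ : ∃ M : Matrix (Fin 7) (Fin 7) (MvPolynomial (Fin 3 × Fin 3) ℂ), M =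
      !![1, 0, 0, 0, 0, 0, -1;
         0, 1, 0, 0, 0, 0, 0;
         0, 0, 1, 0, 0, 0, 0;
         0, 0, 0, 1, 0, 0, 0;
         0, 0, 0, 0, 1, 0, 0;
         0, 0, 0, 0, 0, 1, 0;
         0, 0, 0, 0, 0, 0, 1] := ⟨_, rfl⟩
  obtain ⟨Bq, hBq⟩ : ∃ M : Matrix (Fin 7) (Fin 7) (MvPolynomial (Fin 3 × Fin 3) ℂ), M =
      !![0, X (0, 0), X (1, 0), X (2, 0), 0, 0, 0;
         0, 1, 0, 0, 0, X (2, 1), X (1, 1);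
         0, 0, 1, 0, X (2, 1), 0, X (0, 1);
         0, 0, 0, 1, X (1, 1), X (0, 1), 0;
         X (0, 2), 0, 0, 0, 1, 0, -X (0, 2);
         X (1, 2), 0, 0, 0, 0, 1, -X (1, 2);
         X (2, 2), 0, 0, 0, 0, 0, 1 - X (2, 2)] := ⟨_, rfl⟩
  obtain ⟨Bc, hBc⟩ : ∃ M : Matrix (Fin 7) (Fin 7) (MvPolynomial (Fin 3 × Fin 3) ℂ), M =
      !![0, X (0, 0), X (1, 0), X (2, 0), 0, 0, 0;
         0, 1 - X (0, 0), -X (1, 0), -X (2, 0), 0, X (2, 1), X (1, 1);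
         0, 0, 1, 0, X (2, 1), 0, X (0, 1);
         0, 0, 0, 1, X (1, 1), X (0, 1), 0;
         X (0, 2), 0, 0, 0, 1, 0, -X (0, 2);
         X (1, 2), 0, 0, 0, 0, 1, -X (1, 2);
         X (2, 2), 0, 0, 0, 0, 0, 1 - X (2, 2)] := ⟨_, rfl⟩
  have gA_mul_Qc : gA * Qc = Bq := by
    rw [hgA, hQc, hBq]
    refine Matrix.ext fun i j => ?_
    fin_cases i <;> fin_cases j <;> simp [Matrix.mul_apply, Fin.sum_univ_seven]
    all_goals ring
  have Pc_mul_Bq : Pc * Bq = Bc := by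
    rw [hPc, hBq, hBc]
    refine Matrix.ext fun i j => ?_
    fin_cases i <;> fin_cases j <;> simp [Matrix.mul_apply, Fin.sum_univ_seven]
    all_goals ring
  have hPct : Pc.BlockTriangular OrderDual.toDual := by
    rw [hPc]; intro i j hij
    fin_cases i <;> fin_cases j <;> first | exact absurd hij (by decide) | simp
  have det_Pc : Pc.det = 1 := by
    rw [Matrix.det_of_lowerTriangular Pc hPct, Fin.prod_univ_seven, hPc]; simp
  have hQct : Qc.BlockTriangular id := by
    rw [hQc]; intro i j hij
    fin_cases i <;> fin_cases j <;> first | exact absurd hij (by decide) | simp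
  have det_Qc : Qc.det = 1 := by
    rw [Matrix.det_of_upperTriangular hQct, Fin.prod_univ_seven, hQc]; simp
  have det_Bc : Bc.det = perPoly (Fin 3) ℂ := by
    rw [← Pc_mul_Bq, ← gA_mul_Qc, Matrix.det_mul, Matrix.det_mul, det_Pc, det_Qc, det_gA, one_mul,
      mul_one]
  have isAffineDetRepr_Bc : IsAffineDetRepr (perPoly (Fin 3) ℂ) Bc := by
    refine ⟨fun i j => ?_, det_Bc⟩
    rw [hBc]
    fin_cases i <;> fin_cases j <;> simp [totalDegree_X, totalDegree_neg] <;>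
      exact (totalDegree_sub _ _).trans (max_le (by simp) (by simp [totalDegree_X]))
  -- two points of `V(per₃)` at which a whole row of `Bc` vanishes
  obtain ⟨p₁, hp₁⟩ : ∃ p : Fin 3 × Fin 3 → ℂ, p = fun rc => if rc = (0, 0) ∨ rc = (2, 2) then 1 else 0 :=
    ⟨_, rfl⟩
  have eval_zero_perPoly₃ : eval (fun _ => (0 : ℂ)) (perPoly (Fin 3) ℂ) = 0 := by
    rw [perPoly_three_eq, hper₃]; simp
  have eval_p₁_perPoly₃ : eval p₁ (perPoly (Fin 3) ℂ) = 0 := by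
    rw [perPoly_three_eq, hper₃, hp₁]; simp
  have eval_zero_Bc_row_s : ∀ k, eval (fun _ => (0 : ℂ)) (Bc 0 k) = 0 := by
    intro k; rw [hBc]; fin_cases k <;> simp
  have eval_p₁_Bc_row_u₀ : ∀ k, eval p₁ (Bc 1 k) = 0 := by
    intro k; rw [hBc, hp₁]; fin_cases k <;> simp
  -- every column of `adj Bc` dies at one of the two points
  have key : ∀ (p : Fin 3 × Fin 3 → ℂ) (r : Fin 7), (∀ k, eval p (Bc r k) = 0) → ∀ j, j ≠ r →
      ∀ i, eval p (Bc.adjugate i j) = 0 := by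
    intro p r hr j hjr i
    have hmap := RingHom.map_adjugate (eval p) Bc
    rw [RingHom.mapMatrix_apply, RingHom.mapMatrix_apply] at hmap
    have hij : eval p (Bc.adjugate i j) = (Bc.map (eval p)).adjugate i j := by
      simpa [Matrix.map_apply] using congr_fun (congr_fun hmap i) j
    rw [hij]
    exact adjugate_eq_zero_of_row_eq_zero _ r (fun k => by simpa [Matrix.map_apply] using hr k) i j hjr
  have column_vanishes : ∀ j : Fin 7, ∃ p : Fin 3 × Fin 3 → ℂ,
      eval p (perPoly (Fin 3) ℂ) = 0 ∧ ∀ i, eval p (Bc.adjugate i j) = 0 := by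
    intro j
    by_cases hj : j = 0
    · exact ⟨p₁, eval_p₁_perPoly₃, key p₁ 1 eval_p₁_Bc_row_u₀ j (by rw [hj]; decide)⟩
    · exact ⟨fun _ => 0, eval_zero_perPoly₃, key _ 0 eval_zero_Bc_row_s j hj⟩
  -- the strengthening fails at `Bc`
  obtain ⟨j, hj⟩ := h 3 le_rfl 7 Bc isAffineDetRepr_Bc
  obtain ⟨p, hper, hp⟩ := column_vanishes j
  have hle : Ideal.span (insert (perPoly (Fin 3) ℂ) (Set.range fun i => Bc.adjugate i j)) ≤
      RingHom.ker (eval p) := by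
    rw [Ideal.span_le]
    rintro f (rfl | ⟨i, rfl⟩)
    · exact hper
    · exact hp i
  have h1 := hle hj
  rw [RingHom.mem_ker, map_one] at h1
  exact one_ne_zero h1

/-- **"Some cofactor is a non-zero constant modulo `per_n`" is false** (it would make that cofactor's
column unimodular). [folklore] -/
theorem not_unitCofactor :
    ¬ ∀ n : ℕ, 3 ≤ n → ∀ (m : ℕ) (A : Matrix (Fin m) (Fin m) (MvPolynomial (Fin n × Fin n) ℂ)),
      IsAffineDetRepr (perPoly (Fin n) ℂ) A →
      ∃ (i j : Fin m) (κ : ℂ), κ ≠ 0 ∧ A.adjugate i j - C κ ∈ Ideal.span {perPoly (Fin n) ℂ} := by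
  intro h
  refine not_unimodularColumn fun n hn m A hA => ?_
  obtain ⟨i, j, κ, hκ, hmem⟩ := h n hn m A hA
  exact ⟨j, unimodularColumn_of_unitCofactor A hκ hmem⟩

end Summit.ValiantsHypothesis.Theorems.RankOneTrivialisationNegative.UnitCofactor
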